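import Mathlib.Analysis.Analytic.Binomial
import Mathlib.NumberTheory.LSeries.HurwitzZeta
import Mathlib.Analysis.Complex.LocallyUniformLimit
import Mathlib.Analysis.PSeries
import Mathlib.Analysis.Normed.Module.Connected
import HarnessLib

/-!
# Platt's Algorithm 1: interpolating the Hurwitz zeta function in its parameter
# (Math. Comp. 85 (2016) §6.1, Lemmas 6.2–6.3)

Topic `Literature/NumberTheory/LFunctions`; namespace `Literature.NumberTheory.LFunctions`, engine
sub-namespace `HurwitzTaylor`. Everything in this file is PROVED (no named fact, no new definition).
Typed for the parity-realchar cell (D-0088 (4) literature-typing layer, row «Platt 2016 (Math. Comp.,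
certified GRH/`L`-function computations)»): instrument provenance for the first of the two algorithms
behind Platt's GRH verification `Literature.NumberTheory.LFunctions.platt2016_theorem71/72`
(`DirichletLRiemannHypothesisUpTo.lean`) — "Algorithm 1" (journal §6; arXiv:1305.3087v1 §4), which
evaluates all `L_χ(1/2 + it)` of a modulus `q` at once through
`L_χ(s) = q^{-s} Σ_{a=1}^{q} χ(a) ζ(s, a/q)` (p. 3016; this is the DEFINITION of Mathlib's
`ZMod.LFunction`/`DirichletCharacter.LFunction`: `LFunction Φ s = q^{-s} Σ_j Φ(j) ζ(s, j/q)`) and a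
length-`φ(q)` DFT (Lemma 6.1, a complexity statement), the values `ζ(1/2 + it, a/q)` being INTERPOLATED
from a precomputed table `ζ₁(1/2 + it + k, a/2^{11})`, `0 ≤ k < τ = 15`, by the Taylor expansion of
`ζ(s, α)` in the parameter `α` (Lemma 6.2) truncated after `τ` terms with a certified remainder
(Lemma 6.3; "δ ≤ 2^{-12} … absolute error < 6·10^{-7} at height t = 10000", §9.3 p. 3024). Algorithm 1
served the moduli `q ≥ 10000` (heights `≤ 10^8/q`), Algorithm 2 (Booker's FFT method; its DFT pair and
up-sampling certificates are `CertifiedLFunctionDFTPair.lean`, `CertifiedLFunctionUpsampling.lean`) the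
smaller ones (§9.2 p. 3024).

Source: D. J. Platt, *Numerical computations concerning the GRH*, Math. Comp. **85** (2016) 3009–3027
[Platt2016GRH], §6 pp. 3014–3017 (journal pdf, AMS open access; page-checked). Numbering: journal
Lemma 6.2 = arXiv:1305.3087v1 Lemma 4.2 (there with `ζ_M = ζ - Σ_{n≤M}(n+α)^{-s}` in place of `ζ₁`);
journal Lemma 6.3 has no arXiv counterpart.

## Contents (all proved)

* `platt2016_lemma62` — **Lemma 6.2 as printed**: for `s ∉ {1} ∪ ℤ_{≤0}`, `α ∈ (0,1]`, `|δ| < α`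
  (and `α + δ ≤ 1`, so that `ζ(s, α+δ)` is defined),
  `ζ(s, α+δ) = Σ_{k ≥ 0} (-δ)^k ζ(s+k, α) ∏_{j<k}(s+j) / k!` as a `HasSum` for Mathlib's
  `HurwitzZeta.hurwitzZeta`.
* `platt2016_lemma62_zeta1` — the same for `ζ₁(s, α) = ζ(s, α) - α^{-s}` ("in practice", p. 3016).
* `platt2016_lemma63_majorant` — the truncation error after `τ` terms (Lemma 6.3) in the rigorous form
  `≤ ‖s⋯(s+τ-1)‖ ζ₁(Re s+τ, α) |δ|^τ / (τ!(1 - r))`, `r = max(1,(|s|+τ)/(τ+1))·|δ|/(1+α)`; see its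
  docstring for the exact relation to the printed expression (which has `|ζ₁(s+τ, α)|` and the ratio
  `(|s|+τ)δ/(τ+1)`).
* Engine (`HurwitzTaylor.*`): the binomial series with rising-factorial coefficients
  (`hasSum_one_add_cpow_neg`, from Mathlib's `Complex.one_add_cpow_hasFPowerSeriesOnBall_zero` and
  `ringChoose_neg_eq : Ring.choose (-s) k = (-1)^k ∏_{j<k}(s+j)/k!`), its real majorant
  (`summable_pochhammer_mul_pow`), real majorants of `ζ(w, α)`, `ζ₁(w, α)` uniform in `Re w`
  (`norm_hurwitzZeta_le`, `norm_hurwitzZeta_sub_le`), the fibrewise expansion (`hasSum_fiber`), the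
  `Re s > 1` case by absolute summability of the double family (`hasSum_taylor_of_one_lt_re`), the
  holomorphy of the series on `ℂ ∖ {1, 0, -1, …}` by locally uniform majorants
  (`differentiableOn_tsum_terms`), and the topology of that set (`isClosed_range_one_sub_nat`,
  `isPreconnected_compl_range`).

## Method

The printed proof ("Starting with `Re s > 1` and differentiating term by term … the result follows for
`Re s > 1` by Taylor's theorem. The Taylor expansion also gives us the analytic continuation to
`ℂ ∖ ℤ_{≤0}`") is followed with the derivative-free bookkeeping that Mathlib makes cheapest: instead of
`∂_α^k ζ(s, α) = (-1)^k s⋯(s+k-1) ζ(s+k, α)` we expand each Dirichlet term `(n+α+δ)^{-s}` by the binomial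
series and rearrange the absolutely convergent double series (§3), then continue in `s` by the
identity theorem (Mathlib's `AnalyticOnNhd.eqOn_of_preconnected_of_eventuallyEq`) on the connected open set
`ℂ ∖ {1, 0, -1, …}`, where the series is holomorphic by `Complex.differentiableOn_tsum_of_summable_norm`
on small discs (§4). Differentiability of Mathlib's `hurwitzZeta a s` in the parameter `a` is never
needed.

NOT here: Lemma 6.1 (the `O(q log q)` DFT over `(ℤ/qℤ)ˣ` — an algorithmic statement), the printed
inequality of Lemma 6.3 verbatim (see `platt2016_lemma63_majorant`), the numerics of §9.3, and the
arXiv variant with `ζ_M`.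

`lean search` (2026-08-27): Mathlib has `hurwitzZeta`, its Dirichlet series and `s`-holomorphy, the
binomial series `binomialSeries`/`Ring.choose`; the tree has Euler–Maclaurin for `ζ(s, a)`
(`HurwitzEulerMaclaurin.lean`) and a certified evaluator (`HurwitzCertifiedEvaluation.lean`) but no
Taylor expansion in the parameter; nothing is restated.

## References

* [Platt2016GRH] D. J. Platt, *Numerical computations concerning the GRH*, Math. Comp. 85 (2016),
  no. 302, 3009–3027, doi:10.1090/mcom/3077: §6 "Algorithm 1", Lemma 6.2 p. 3016, Lemma 6.3
  pp. 3016–3017, §9.2–9.3 p. 3024 (arXiv:1305.3087v1: §4, Lemma 4.2).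
* T. M. Apostol, *Introduction to Analytic Number Theory*, Springer 1976, §12 (Hurwitz zeta function and
  `L(s, χ) = q^{-s} Σ_a χ(a) ζ(s, a/q)`; Platt's reference [1]). [folklore]
-/

noncomputable section

open Complex Filter Topology Set HurwitzZeta

open scoped Nat

namespace Literature.NumberTheory.LFunctions

namespace HurwitzTaylor

/-! ## §1 The Taylor coefficients: binomial series with rising factorials -/

/-- The generalised binomial coefficient at a negated argument is a signed rising factorial:
`C(-s, k) = (-1)^k · s(s+1)⋯(s+k-1) / k!`. [folklore] -/
private theorem ringChoose_neg_eq (s : ℂ) (k : ℕ) :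
    Ring.choose (-s) k = (-1) ^ k * (∏ j ∈ Finset.range k, (s + j)) / (k ! : ℂ) := by
  have h1 : Ring.choose (-s) k = (∏ j ∈ Finset.range k, (-s - j)) / k ! := by
    rw [Ring.choose_eq_smul, ← Polynomial.aeval_eq_smeval, Polynomial.aeval_def,
      Polynomial.eval₂_eq_eval_map, descPochhammer_map, descPochhammer_eval_eq_prod_range,
      smul_eq_mul, div_eq_inv_mul]
  have h2 : ∀ k : ℕ, ∏ j ∈ Finset.range k, (-s - (j : ℂ)) =
      (-1) ^ k * ∏ j ∈ Finset.range k, (s + j) := by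
    intro k
    induction k with
    | zero => simp
    | succ k ih => rw [Finset.prod_range_succ, Finset.prod_range_succ, ih]; ring
  rw [h1, h2]

/-- `‖u‖ < 1 ≤ r` puts `u` in the extended ball of radius `r` about `0`. [folklore] -/
private theorem mem_eball_of_norm_lt_one {u : ℂ} (hu : ‖u‖ < 1) {r : ENNReal} (hr : 1 ≤ r) :
    u ∈ Metric.eball (0 : ℂ) r := by
  rw [Metric.mem_eball, edist_zero_right, ← ofReal_norm]
  exact lt_of_lt_of_le (ENNReal.ofReal_lt_one.mpr hu) hr

/-- **The binomial series with a rising-factorial coefficient**: for `‖u‖ < 1` and every `s ∈ ℂ`,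
`(1 + u)^{-s} = Σ_{k ≥ 0} (-1)^k s(s+1)⋯(s+k-1)/k! · u^k` (principal branch; Mathlib's
`Complex.one_add_cpow_hasFPowerSeriesOnBall_zero` with the coefficient rewritten by
`ringChoose_neg_eq`). With `u = δ/(n+α)` this is the Taylor expansion of one summand in Platt's proof
("differentiating term by term … `ζ^{(k)}(s, α) = Σ_n (-1)^k s(s+1)⋯(s+k-1)(n+α)^{-s-k}` … and the
result follows … by Taylor's theorem"). [cite: Platt2016GRH, Lemma 6.2 p. 3016 (proof)] -/
theorem hasSum_one_add_cpow_neg (s u : ℂ) (hu : ‖u‖ < 1) :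
    HasSum (fun k : ℕ => (-1) ^ k * (∏ j ∈ Finset.range k, (s + j)) / (k ! : ℂ) * u ^ k)
      ((1 + u) ^ (-s)) := by
  have h := (Complex.one_add_cpow_hasFPowerSeriesOnBall_zero (a := -s)).hasSum
    (mem_eball_of_norm_lt_one hu le_rfl)
  have key : (fun k : ℕ => binomialSeries ℂ (-s) k fun _ => u) =
      fun k : ℕ => (-1) ^ k * (∏ j ∈ Finset.range k, (s + j)) / (k ! : ℂ) * u ^ k := by
    funext k
    rw [binomialSeries_apply, List.prod_ofFn, Fin.prod_const, smul_eq_mul, ringChoose_neg_eq]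
  rw [key, zero_add] at h
  exact h

/-- Absolute convergence of the binomial series of `hasSum_one_add_cpow_neg` inside the unit disc.
[folklore] -/
private theorem summable_norm_one_add_cpow_neg (s u : ℂ) (hu : ‖u‖ < 1) :
    Summable (fun k : ℕ => ‖(-1) ^ k * (∏ j ∈ Finset.range k, (s + j)) / (k ! : ℂ) * u ^ k‖) := by
  have h := (binomialSeries ℂ (-s)).summable_norm_apply
    (mem_eball_of_norm_lt_one hu binomialSeries_radius_ge_one)
  have key : (fun k : ℕ => ‖binomialSeries ℂ (-s) k fun _ => u‖) =
      fun k : ℕ => ‖(-1) ^ k * (∏ j ∈ Finset.range k, (s + j)) / (k ! : ℂ) * u ^ k‖ := by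
    funext k
    rw [binomialSeries_apply, List.prod_ofFn, Fin.prod_const, smul_eq_mul, ringChoose_neg_eq]
  rw [key] at h
  exact h

/-- The real majorant series `Σ_k R(R+1)⋯(R+k-1)/k! · x^k` (`= (1-x)^{-R}`) converges for `R ≥ 0`,
`0 ≤ x < 1`. [folklore] -/
private theorem summable_pochhammer_mul_pow {R x : ℝ} (hR : 0 ≤ R) (hx0 : 0 ≤ x) (hx : x < 1) :
    Summable (fun k : ℕ => (∏ j ∈ Finset.range k, (R + j)) / k ! * x ^ k) := by
  have hu : ‖((x : ℝ) : ℂ)‖ < 1 := by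
    rw [Complex.norm_real, Real.norm_eq_abs, abs_of_nonneg hx0]; exact hx
  have h := summable_norm_one_add_cpow_neg (R : ℂ) (x : ℂ) hu
  refine h.congr fun k => ?_
  have hP : (∏ j ∈ Finset.range k, ((R : ℂ) + j)) = ((∏ j ∈ Finset.range k, (R + j) : ℝ) : ℂ) := by
    push_cast; rfl
  rw [norm_mul, norm_div, norm_mul, norm_pow, norm_neg, norm_one, one_pow, one_mul, hP,
    Complex.norm_real, Complex.norm_natCast, norm_pow, Complex.norm_real, Real.norm_eq_abs,
    Real.norm_eq_abs, abs_of_nonneg hx0, abs_of_nonneg]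
  exact Finset.prod_nonneg fun j _ => by positivity

/-- `‖s(s+1)⋯(s+k-1)‖ ≤ R(R+1)⋯(R+k-1)` for `‖s‖ ≤ R`. [folklore] -/
private theorem norm_pochhammer_le (s : ℂ) {R : ℝ} (hR : ‖s‖ ≤ R) (k : ℕ) :
    ‖∏ j ∈ Finset.range k, (s + j)‖ ≤ ∏ j ∈ Finset.range k, (R + j) := by
  rw [norm_prod]
  refine Finset.prod_le_prod (fun j _ => norm_nonneg _) fun j _ => ?_
  calc ‖s + (j : ℂ)‖ ≤ ‖s‖ + ‖(j : ℂ)‖ := norm_add_le _ _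
    _ = ‖s‖ + j := by rw [Complex.norm_natCast]
    _ ≤ R + j := by linarith

/-- The Taylor coefficient bound `‖(-δ)^k s(s+1)⋯(s+k-1)/k!‖ ≤ |δ|^k R(R+1)⋯(R+k-1)/k!` for `‖s‖ ≤ R`.
[folklore] -/
private theorem norm_coef_le (s : ℂ) {R : ℝ} (hR : ‖s‖ ≤ R) (δ : ℝ) (k : ℕ) :
    ‖(-(δ : ℂ)) ^ k * (∏ j ∈ Finset.range k, (s + j)) / (k ! : ℂ)‖ ≤
      |δ| ^ k * ((∏ j ∈ Finset.range k, (R + j)) / k !) := by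
  rw [norm_div, norm_mul, norm_pow, norm_neg, Complex.norm_real, Real.norm_eq_abs,
    Complex.norm_natCast, mul_div_assoc]
  gcongr
  exact norm_pochhammer_le s hR k

/-- `‖(-δ)^k s(s+1)⋯(s+k-1)/k!‖ = |δ|^k ‖s(s+1)⋯(s+k-1)‖/k!`. [folklore] -/
private theorem norm_coef_eq (s : ℂ) (δ : ℝ) (k : ℕ) :
    ‖(-(δ : ℂ)) ^ k * (∏ j ∈ Finset.range k, (s + j)) / (k ! : ℂ)‖ =
      |δ| ^ k * (‖∏ j ∈ Finset.range k, (s + j)‖ / k !) := by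
  rw [norm_div, norm_mul, norm_pow, norm_neg, Complex.norm_real, Real.norm_eq_abs,
    Complex.norm_natCast, mul_div_assoc]

/-- **Growth of the Taylor coefficients past the truncation point**:
`‖s(s+1)⋯(s+τ+m-1)‖/(τ+m)! ≤ ρ^m · ‖s(s+1)⋯(s+τ-1)‖/τ!` with `ρ = max(1, (‖s‖+τ)/(τ+1))`, because each
ratio `‖s+k‖/(k+1) ≤ (‖s‖+k)/(k+1)` (`k ≥ τ`) is `≤ 1` when `‖s‖ ≤ 1` and decreasing in `k` when `‖s‖ > 1`
— the coefficient half of the printed "common ratio `(|s|+τ)δ/(τ+1)`" (which presumes the second case).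
[cite: Platt2016GRH, Lemma 6.3 pp. 3016–3017 (proof)] -/
theorem norm_pochhammer_div_factorial_le (s : ℂ) (τ m : ℕ) :
    ‖∏ j ∈ Finset.range (τ + m), (s + j)‖ / (τ + m) ! ≤
      max 1 ((‖s‖ + τ) / (τ + 1)) ^ m * (‖∏ j ∈ Finset.range τ, (s + j)‖ / τ !) := by
  set ρ : ℝ := max 1 ((‖s‖ + τ) / (τ + 1)) with hρ
  have hρ1 : 1 ≤ ρ := le_max_left _ _
  -- the ratio bound
  have hratio : ∀ k : ℕ, τ ≤ k → ‖s + (k : ℂ)‖ / (k + 1) ≤ ρ := by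
    intro k hk
    have hk' : (τ : ℝ) ≤ k := by exact_mod_cast hk
    have h1 : ‖s + (k : ℂ)‖ ≤ ‖s‖ + k := by
      calc ‖s + (k : ℂ)‖ ≤ ‖s‖ + ‖(k : ℂ)‖ := norm_add_le _ _
        _ = ‖s‖ + k := by rw [Complex.norm_natCast]
    have hk1 : (0 : ℝ) < k + 1 := by positivity
    rw [div_le_iff₀ hk1]
    by_cases hs1 : ‖s‖ ≤ 1
    · calc ‖s + (k : ℂ)‖ ≤ ‖s‖ + k := h1
        _ ≤ 1 * (k + 1) := by linarith
        _ ≤ ρ * (k + 1) := by gcongr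
    · rw [not_le] at hs1
      have h2 : (‖s‖ + k) ≤ (‖s‖ + τ) / (τ + 1) * (k + 1) := by
        rw [div_mul_eq_mul_div, le_div_iff₀ (by positivity)]
        nlinarith
      calc ‖s + (k : ℂ)‖ ≤ ‖s‖ + k := h1
        _ ≤ (‖s‖ + τ) / (τ + 1) * (k + 1) := h2
        _ ≤ ρ * (k + 1) := by gcongr; exact le_max_right _ _
  induction m with
  | zero => simp
  | succ m ih =>
    rw [show τ + (m + 1) = (τ + m) + 1 by ring, Finset.prod_range_succ, norm_mul,
      Nat.factorial_succ, Nat.cast_mul, pow_succ]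
    have hfac : (0 : ℝ) < ((τ + m) ! : ℝ) := by positivity
    have hk1 : (0 : ℝ) < ((τ + m : ℕ) : ℝ) + 1 := by positivity
    calc ‖∏ j ∈ Finset.range (τ + m), (s + j)‖ * ‖s + ((τ + m : ℕ) : ℂ)‖ /
          ((((τ + m : ℕ) + 1 : ℕ) : ℝ) * ((τ + m) ! : ℝ))
        = (‖∏ j ∈ Finset.range (τ + m), (s + j)‖ / (τ + m) !) *
            (‖s + ((τ + m : ℕ) : ℂ)‖ / (((τ + m : ℕ) : ℝ) + 1)) := by
          push_cast; field_simp
      _ ≤ (ρ ^ m * (‖∏ j ∈ Finset.range τ, (s + j)‖ / τ !)) * ρ :=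
          mul_le_mul ih (hratio (τ + m) (Nat.le_add_right τ m)) (by positivity) (by positivity)
      _ = ρ ^ m * ρ * (‖∏ j ∈ Finset.range τ, (s + ↑j)‖ / ↑τ !) := by ring

/-! ## §2 Real majorants of `ζ(w, α)` and `ζ₁(w, α)` for `Re w > 1` -/

/-- The real Hurwitz series `Σ_{n ≥ 0} (n+α)^{-x}` converges for `α > 0`, `x > 1` (Mathlib's
`Real.summable_one_div_nat_add_rpow` without the absolute value). [folklore] -/
private theorem summable_one_div_nat_add_rpow {α : ℝ} (hα : 0 < α) {x : ℝ} (hx : 1 < x) :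
    Summable (fun n : ℕ => 1 / ((n : ℝ) + α) ^ x) := by
  have := (Real.summable_one_div_nat_add_rpow α x).mpr hx
  refine this.congr fun n => ?_
  rw [abs_of_pos (by positivity)]

/-- `‖(n+α)^{-w}‖ = (n+α)^{-Re w}` for `α > 0`. [folklore] -/
private theorem norm_one_div_nat_add_cpow (n : ℕ) {α : ℝ} (hα : 0 < α) (w : ℂ) :
    ‖1 / ((n : ℂ) + α) ^ w‖ = ((n : ℝ) + α) ^ (-w.re) := by
  rw [show ((n : ℂ) + α) = ((n + α : ℝ) : ℂ) by push_cast; ring, norm_div, norm_one,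
    Complex.norm_cpow_eq_rpow_re_of_pos (by positivity), Real.rpow_neg (by positivity), one_div]

/-- **A real majorant of `ζ(w, α)` in the half-plane of absolute convergence, uniform in `Re w`:**
for `0 < α ≤ 1` and `1 < x ≤ Re w`, `‖ζ(w, α)‖ ≤ α^{x - Re w} · Σ_{n ≥ 0} (n+α)^{-x}` (termwise:
`(n+α)^{-Re w} = (n+α)^{x-Re w}(n+α)^{-x} ≤ α^{x-Re w}(n+α)^{-x}` as `n + α ≥ α` and `x - Re w ≤ 0`).
The factor `α^{x-Re w} = α^{x}·α^{-Re w}` isolates the growth of the `n = 0` term `α^{-w}`.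
[folklore] -/
private theorem norm_hurwitzZeta_le {α : ℝ} (hα : 0 < α) (hα1 : α ≤ 1) {x : ℝ} (hx : 1 < x) {w : ℂ}
    (hxw : x ≤ w.re) :
    ‖hurwitzZeta (α : UnitAddCircle) w‖ ≤ α ^ (x - w.re) * ∑' n : ℕ, 1 / ((n : ℝ) + α) ^ x := by
  have hw : 1 < w.re := lt_of_lt_of_le hx hxw
  have hS := hasSum_hurwitzZeta_of_one_lt_re ⟨hα.le, hα1⟩ hw
  have hT := ((summable_one_div_nat_add_rpow hα hx).hasSum).mul_left (α ^ (x - w.re))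
  refine hS.norm_le_of_bounded hT fun n => ?_
  rw [norm_one_div_nat_add_cpow n hα w]
  have hy : 0 < (n : ℝ) + α := by positivity
  have h1 : ((n : ℝ) + α) ^ (-w.re) = ((n : ℝ) + α) ^ (x - w.re) * (1 / ((n : ℝ) + α) ^ x) := by
    rw [one_div, ← Real.rpow_neg hy.le, ← Real.rpow_add hy]; ring_nf
  rw [h1]
  exact mul_le_mul_of_nonneg_right
    (Real.rpow_le_rpow_of_nonpos hα (by linarith [(n.cast_nonneg : (0 : ℝ) ≤ n)]) (by linarith))
    (by positivity)

/-- The Dirichlet series of Platt's `ζ₁(w, α) := ζ(w, α) - α^{-w} = Σ_{n ≥ 1} (n+α)^{-w}` (`Re w > 1`,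
`0 < α ≤ 1`; journal p. 3016 "In practice, it is better to work with `ζ₁(s,α) = ζ(s,α) - α^{-s}`").
[cite: Platt2016GRH, §6.1 p. 3016] -/
theorem hasSum_hurwitzZeta_sub {α : ℝ} (hα : 0 < α) (hα1 : α ≤ 1) {w : ℂ} (hw : 1 < w.re) :
    HasSum (fun n : ℕ => 1 / ((n : ℂ) + 1 + α) ^ w)
      (hurwitzZeta (α : UnitAddCircle) w - (α : ℂ) ^ (-w)) := by
  have h := hasSum_hurwitzZeta_of_one_lt_re ⟨hα.le, hα1⟩ hw
  rw [← hasSum_nat_add_iff' 1] at h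
  simp only [Finset.range_one, Finset.sum_singleton, Nat.cast_zero, zero_add, Nat.cast_add,
    Nat.cast_one, one_div] at h
  rw [← Complex.cpow_neg] at h
  simpa only [one_div] using h

/-- **Real majorant of `ζ₁(w, α) = ζ(w, α) - α^{-w}`:** for `0 < α ≤ 1` and `1 < x ≤ Re w`,
`‖ζ₁(w, α)‖ ≤ (1+α)^{x - Re w} · Σ_{n ≥ 1} (n+α)^{-x}` (termwise, using `n + α ≥ 1 + α` for `n ≥ 1`).
With `x = Re s + τ`, `w = s + k` (`k ≥ τ`) this is the decay `ζ₁(Re s + k, α) ≤ (1+α)^{τ-k} ζ₁(Re s+τ, α)`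
of the omitted coefficients — the rigorous substitute for the ratio step of the printed proof of
Lemma 6.3 ("the geometric sequence with this first term"). [cite: Platt2016GRH, Lemma 6.3 pp. 3016–3017 (proof)] -/
theorem norm_hurwitzZeta_sub_le {α : ℝ} (hα : 0 < α) (hα1 : α ≤ 1) {x : ℝ} (hx : 1 < x) {w : ℂ}
    (hxw : x ≤ w.re) :
    ‖hurwitzZeta (α : UnitAddCircle) w - (α : ℂ) ^ (-w)‖ ≤
      (1 + α) ^ (x - w.re) * ∑' n : ℕ, 1 / ((n : ℝ) + 1 + α) ^ x := by
  have hw : 1 < w.re := lt_of_lt_of_le hx hxw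
  have hS := hasSum_hurwitzZeta_sub hα hα1 hw
  have hsum : Summable fun n : ℕ => 1 / ((n : ℝ) + 1 + α) ^ x := by
    have := (summable_nat_add_iff 1).mpr (summable_one_div_nat_add_rpow hα hx)
    refine this.congr fun n => ?_
    push_cast
    ring_nf
  have hT := hsum.hasSum.mul_left ((1 + α) ^ (x - w.re))
  refine hS.norm_le_of_bounded hT fun n => ?_
  have e1 : ((n : ℂ) + 1 + α) = (((n + 1 : ℕ) : ℂ) + α) := by push_cast; ring
  have e2 : ((n : ℝ) + 1 + α) = (((n + 1 : ℕ) : ℝ) + α) := by push_cast; ring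
  rw [e1, norm_one_div_nat_add_cpow (n + 1) hα w, e2]
  have hy : 0 < ((n + 1 : ℕ) : ℝ) + α := by positivity
  have hy1 : 1 + α ≤ ((n + 1 : ℕ) : ℝ) + α := by push_cast; linarith [(n.cast_nonneg : (0 : ℝ) ≤ n)]
  have h1 : (((n + 1 : ℕ) : ℝ) + α) ^ (-w.re) =
      (((n + 1 : ℕ) : ℝ) + α) ^ (x - w.re) * (1 / (((n + 1 : ℕ) : ℝ) + α) ^ x) := by
    rw [one_div, ← Real.rpow_neg hy.le, ← Real.rpow_add hy]; ring_nf
  rw [h1]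
  exact mul_le_mul_of_nonneg_right
    (Real.rpow_le_rpow_of_nonpos (by positivity) hy1 (by linarith)) (by positivity)

/-! ## §3 Lemma 6.2 for `Re s > 1`: termwise expansion and rearrangement -/

/-- **One fibre of the double series** — the Taylor expansion in `δ` of a single Dirichlet term:
for `α > 0`, `|δ| < α`, every `s ∈ ℂ` and `n ≥ 0`,
`(n + α + δ)^{-s} = Σ_{k ≥ 0} (-δ)^k s(s+1)⋯(s+k-1)/k! · (n+α)^{-(s+k)}`
(`(n+α+δ)^{-s} = (n+α)^{-s}(1 + δ/(n+α))^{-s}` for the positive reals `n+α`, `1 + δ/(n+α)`, and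
`|δ/(n+α)| ≤ |δ|/α < 1`) — the printed "differentiating term by term" step, summand by summand.
[cite: Platt2016GRH, Lemma 6.2 p. 3016 (proof)] -/
theorem hasSum_fiber {α δ : ℝ} (hα : 0 < α) (hδ : |δ| < α) (s : ℂ) (n : ℕ) :
    HasSum (fun k : ℕ => (-(δ : ℂ)) ^ k * (∏ j ∈ Finset.range k, (s + j)) / (k ! : ℂ) *
        (1 / ((n : ℂ) + α) ^ (s + k)))
      (1 / ((n : ℂ) + ((α + δ : ℝ) : ℂ)) ^ s) := by
  have hαy : α ≤ (n : ℝ) + α := by linarith [(n.cast_nonneg : (0 : ℝ) ≤ n)]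
  have hy0 : 0 < (n : ℝ) + α := lt_of_lt_of_le hα hαy
  have hyc : ((n : ℂ) + α) = (((n : ℝ) + α : ℝ) : ℂ) := by push_cast; ring
  have hyne : ((n : ℂ) + α) ≠ 0 := by rw [hyc]; exact ofReal_ne_zero.mpr hy0.ne'
  have hu1 : |δ / ((n : ℝ) + α)| < 1 := by
    rw [abs_div, abs_of_pos hy0, div_lt_one hy0]
    exact lt_of_lt_of_le hδ hαy
  have hu : ‖((δ / ((n : ℝ) + α) : ℝ) : ℂ)‖ < 1 := by rwa [Complex.norm_real, Real.norm_eq_abs]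
  have h1u : 0 ≤ 1 + δ / ((n : ℝ) + α) := by linarith [(abs_lt.mp hu1).1]
  have h2 := (hasSum_one_add_cpow_neg s _ hu).mul_left (((n : ℂ) + α) ^ (-s))
  have key : (fun k : ℕ => ((n : ℂ) + α) ^ (-s) * ((-1) ^ k * (∏ j ∈ Finset.range k, (s + j)) /
      (k ! : ℂ) * (((δ / ((n : ℝ) + α) : ℝ) : ℂ)) ^ k)) = fun k : ℕ => (-(δ : ℂ)) ^ k *
      (∏ j ∈ Finset.range k, (s + j)) / (k ! : ℂ) * (1 / ((n : ℂ) + α) ^ (s + k)) := by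
    funext k
    rw [one_div, ← Complex.cpow_neg, neg_add, Complex.cpow_add _ _ hyne, Complex.cpow_neg _ (k : ℂ),
      Complex.cpow_natCast]
    push_cast
    rw [div_pow, neg_pow]
    ring
  have hval : ((n : ℂ) + α) ^ (-s) * (1 + (((δ / ((n : ℝ) + α) : ℝ) : ℂ))) ^ (-s) =
      1 / ((n : ℂ) + ((α + δ : ℝ) : ℂ)) ^ s := by
    have e1 : (1 + (((δ / ((n : ℝ) + α) : ℝ) : ℂ))) = (((1 + δ / ((n : ℝ) + α) : ℝ)) : ℂ) := by
      push_cast; ring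
    have e2 : ((n : ℂ) + ((α + δ : ℝ) : ℂ)) =
        (((n : ℝ) + α : ℝ) : ℂ) * (((1 + δ / ((n : ℝ) + α) : ℝ)) : ℂ) := by
      push_cast; field_simp; ring
    rw [e1, hyc, ← Complex.mul_cpow_ofReal_nonneg hy0.le h1u, e2, one_div, Complex.cpow_neg]
  rw [key, hval] at h2
  exact h2

/-- The `n = 0` fibre: `(α + δ)^{-s} = Σ_k (-δ)^k s(s+1)⋯(s+k-1)/k! · α^{-(s+k)}` for `|δ| < α`, all `s`
— the "missing term" by which `ζ₁` differs from `ζ` (p. 3016), expanded.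
[cite: Platt2016GRH, §6.1 p. 3016] -/
theorem hasSum_cpow_neg {α δ : ℝ} (hα : 0 < α) (hδ : |δ| < α) (s : ℂ) :
    HasSum (fun k : ℕ => (-(δ : ℂ)) ^ k * (∏ j ∈ Finset.range k, (s + j)) / (k ! : ℂ) *
        (α : ℂ) ^ (-(s + k)))
      (((α + δ : ℝ) : ℂ) ^ (-s)) := by
  have h := hasSum_fiber hα hδ s 0
  simp only [Nat.cast_zero, zero_add, one_div, ← Complex.cpow_neg] at h
  exact h

/-- **Lemma 6.2 in the half-plane of absolute convergence** (`Re s > 1`): the double family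
`(n, k) ↦ (-δ)^k s(s+1)⋯(s+k-1)/k! · (n+α)^{-(s+k)}` is absolutely summable (majorant
`(n+α)^{-Re s} · ‖s‖(‖s‖+1)⋯(‖s‖+k-1)/k! (|δ|/α)^k`, a product of two convergent series since `|δ| < α`);
summing over `k` first gives `Σ_n (n+α+δ)^{-s} = ζ(s, α+δ)` (`hasSum_fiber`), over `n` first
`Σ_k (-δ)^k s(s+1)⋯(s+k-1)/k! ζ(s+k, α)`. This is the printed proof's "the result follows for `Re s > 1`".
[cite: Platt2016GRH, Lemma 6.2 p. 3016 (proof)] -/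
theorem hasSum_taylor_of_one_lt_re {α δ : ℝ} (hα : 0 < α) (hα1 : α ≤ 1) (hδ : |δ| < α)
    (hαδ : α + δ ≤ 1) {s : ℂ} (hs : 1 < s.re) :
    HasSum (fun k : ℕ => (-(δ : ℂ)) ^ k * (∏ j ∈ Finset.range k, (s + j)) / (k ! : ℂ) *
        hurwitzZeta (α : UnitAddCircle) (s + k))
      (hurwitzZeta ((α + δ : ℝ) : UnitAddCircle) s) := by
  -- the double family
  set F : ℕ × ℕ → ℂ := fun p => (-(δ : ℂ)) ^ p.2 * (∏ j ∈ Finset.range p.2, (s + j)) /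
    (p.2 ! : ℂ) * (1 / ((p.1 : ℂ) + α) ^ (s + p.2)) with hF
  -- its summable majorant `g n * h k`
  set g : ℕ → ℝ := fun n => 1 / ((n : ℝ) + α) ^ s.re with hg
  set h : ℕ → ℝ := fun k => (∏ j ∈ Finset.range k, (‖s‖ + j)) / k ! * (|δ| / α) ^ k with hh
  have hgs : Summable g := summable_one_div_nat_add_rpow hα hs
  have hδα : |δ| / α < 1 := (div_lt_one hα).mpr hδ
  have hhs : Summable h := summable_pochhammer_mul_pow (norm_nonneg s) (by positivity) hδα
  have hg0 : 0 ≤ g := fun n => by simp only [hg]; positivity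
  have hh0 : 0 ≤ h := fun k => by
    simp only [hh]
    exact mul_nonneg (div_nonneg (Finset.prod_nonneg fun j _ => by positivity) (by positivity))
      (by positivity)
  have hgh : Summable fun p : ℕ × ℕ => g p.1 * h p.2 := hgs.mul_of_nonneg hhs hg0 hh0
  have hFle : ∀ p : ℕ × ℕ, ‖F p‖ ≤ g p.1 * h p.2 := by
    rintro ⟨n, k⟩
    simp only [hF, hg, hh]
    rw [norm_mul, norm_one_div_nat_add_cpow n hα]
    have hy : 0 < (n : ℝ) + α := by positivity
    have hre : (s + (k : ℂ)).re = s.re + k := by simp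
    rw [hre]
    have h1 : ((n : ℝ) + α) ^ (-(s.re + k)) ≤ 1 / ((n : ℝ) + α) ^ s.re * α⁻¹ ^ k := by
      rw [neg_add, Real.rpow_add hy, Real.rpow_neg hy.le, one_div]
      gcongr
      rw [Real.rpow_neg hy.le, Real.rpow_natCast, ← inv_pow]
      gcongr
      · linarith [(n.cast_nonneg : (0 : ℝ) ≤ n)]
    calc ‖(-(δ : ℂ)) ^ k * (∏ j ∈ Finset.range k, (s + j)) / (k ! : ℂ)‖ *
          ((n : ℝ) + α) ^ (-(s.re + k))
        ≤ |δ| ^ k * ((∏ j ∈ Finset.range k, (‖s‖ + j)) / k !) *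
            (1 / ((n : ℝ) + α) ^ s.re * α⁻¹ ^ k) := by
          exact mul_le_mul (norm_coef_le s le_rfl δ k) h1 (by positivity) (by positivity)
      _ = 1 / ((n : ℝ) + α) ^ s.re * ((∏ j ∈ Finset.range k, (‖s‖ + j)) / k ! * (|δ| / α) ^ k) := by
          rw [div_pow, div_eq_mul_inv (|δ| ^ k), ← inv_pow]; ring
  have hFs : Summable F := Summable.of_norm_bounded hgh hFle
  have hFsum : HasSum F (∑' p, F p) := hFs.hasSum
  -- summing over `k` first: the Dirichlet series of `ζ(s, α + δ)`
  have hαδ0 : 0 ≤ α + δ := by linarith [(abs_lt.mp hδ).1]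
  have hrows : HasSum (fun n : ℕ => 1 / ((n : ℂ) + ((α + δ : ℝ) : ℂ)) ^ s) (∑' p, F p) :=
    hFsum.prod_fiberwise fun n => hasSum_fiber hα hδ s n
  have hζ := hasSum_hurwitzZeta_of_one_lt_re ⟨hαδ0, hαδ⟩ hs
  have hval : (∑' p, F p) = hurwitzZeta ((α + δ : ℝ) : UnitAddCircle) s := hrows.unique hζ
  -- summing over `n` first: the Dirichlet series of `ζ(s + k, α)`
  have hFswap : HasSum (fun p : ℕ × ℕ => F p.swap) (∑' p, F p) :=
    (Equiv.prodComm ℕ ℕ).hasSum_iff.mpr hFsum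
  have hcols : HasSum (fun k : ℕ => (-(δ : ℂ)) ^ k * (∏ j ∈ Finset.range k, (s + j)) / (k ! : ℂ) *
      hurwitzZeta (α : UnitAddCircle) (s + k)) (∑' p, F p) := by
    refine hFswap.prod_fiberwise fun k => ?_
    have hsk : 1 < (s + (k : ℂ)).re := by simp; linarith
    simpa only [hF, Prod.swap] using (hasSum_hurwitzZeta_of_one_lt_re ⟨hα.le, hα1⟩ hsk).mul_left
      ((-(δ : ℂ)) ^ k * (∏ j ∈ Finset.range k, (s + j)) / (k ! : ℂ))
  rwa [hval] at hcols

/-! ## §4 Analytic continuation to `ℂ ∖ {1, 0, -1, …}` -/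

/-- The exceptional set `{1 - n : n ∈ ℕ} = {1, 0, -1, -2, …}` (the pole of `ζ(·, α)` and Platt's
excluded `ℤ_{≤ 0}`) is closed in `ℂ` (its points are at mutual distance `≥ 1`). [folklore] -/
private theorem isClosed_range_one_sub_nat : IsClosed (Set.range (fun n : ℕ => (1 : ℂ) - n)) := by
  refine Metric.isClosed_of_pairwise_le_dist zero_lt_one ?_
  rintro x ⟨n, rfl⟩ y ⟨m, rfl⟩ hne
  have hnm : (m : ℤ) - n ≠ 0 := by
    intro h
    apply hne
    have : (m : ℤ) = n := sub_eq_zero.mp h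
    have hmn : m = n := by exact_mod_cast this
    simp [hmn]
  rw [Complex.dist_eq, show ((1 : ℂ) - n) - (1 - m) = (((m : ℤ) - n : ℤ) : ℂ) by push_cast; ring,
    Complex.norm_intCast]
  exact_mod_cast Int.one_le_abs hnm

/-- `ℂ ∖ {1, 0, -1, -2, …}` is open. [folklore] -/
private theorem isOpen_compl_range : IsOpen (Set.range (fun n : ℕ => (1 : ℂ) - n))ᶜ :=
  isClosed_range_one_sub_nat.isOpen_compl

/-- `ℂ ∖ {1, 0, -1, -2, …}` is preconnected (complement of a countable set in a real vector space of
dimension `2`). [folklore] -/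
private theorem isPreconnected_compl_range : IsPreconnected (Set.range (fun n : ℕ => (1 : ℂ) - n))ᶜ :=
  ((Set.countable_range _).isPathConnected_compl_of_one_lt_rank
    (by rw [Complex.rank_real_complex]; norm_num)).isConnected.isPreconnected

/-- `2 ∉ {1, 0, -1, -2, …}` (the base point of the identity theorem, inside `Re s > 1`). [folklore] -/
private theorem two_mem_compl_range : (2 : ℂ) ∈ (Set.range (fun n : ℕ => (1 : ℂ) - n))ᶜ := by
  rintro ⟨n, hn⟩
  have h := congrArg Complex.re hn
  simp at h
  have : (0 : ℝ) ≤ n := Nat.cast_nonneg n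
  linarith

/-- Each term `s ↦ (-δ)^k s(s+1)⋯(s+k-1)/k! · ζ(s+k, α)` of the Taylor series is holomorphic at every `s`
with `s + k ≠ 1` (Mathlib's `HurwitzZeta.differentiableAt_hurwitzZeta`). [folklore] -/
private theorem differentiableAt_term (α δ : ℝ) (k : ℕ) {s : ℂ} (hs : s + k ≠ 1) :
    DifferentiableAt ℂ (fun z : ℂ => (-(δ : ℂ)) ^ k * (∏ j ∈ Finset.range k, (z + j)) / (k ! : ℂ) *
      hurwitzZeta (α : UnitAddCircle) (z + k)) s := by
  have h1 : DifferentiableAt ℂ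
      (fun z : ℂ => (-(δ : ℂ)) ^ k * (∏ j ∈ Finset.range k, (z + j)) / (k ! : ℂ)) s := by
    fun_prop
  have h2 : DifferentiableAt ℂ (fun z : ℂ => hurwitzZeta (α : UnitAddCircle) (z + k)) s :=
    (differentiableAt_hurwitzZeta (α : UnitAddCircle) hs).comp s (differentiableAt_id.add_const _)
  exact h1.mul h2

/-- **Uniform majorant of the terms.** For `0 < α ≤ 1`, `‖s‖ ≤ R` and `1 < x ≤ Re s + k`:
`‖(-δ)^k s(s+1)⋯(s+k-1)/k! ζ(s+k, α)‖ ≤ (α^{x - Re s - k} Σ_{n≥0}(n+α)^{-x}) · |δ|^k R(R+1)⋯(R+k-1)/k!`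
(`norm_hurwitzZeta_le` and `norm_coef_le`). With `α^{-k}|δ|^k = (|δ|/α)^k` this is a convergent majorant,
locally uniform in `s`. [folklore] -/
private theorem norm_term_le {α δ : ℝ} (hα : 0 < α) (hα1 : α ≤ 1) {s : ℂ} {R : ℝ} (hR : ‖s‖ ≤ R)
    (k : ℕ) {x : ℝ} (hx : 1 < x) (hxk : x ≤ s.re + k) :
    ‖(-(δ : ℂ)) ^ k * (∏ j ∈ Finset.range k, (s + j)) / (k ! : ℂ) *
        hurwitzZeta (α : UnitAddCircle) (s + k)‖ ≤
      (α ^ (x - s.re - k) * ∑' n : ℕ, 1 / ((n : ℝ) + α) ^ x) *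
        (|δ| ^ k * ((∏ j ∈ Finset.range k, (R + j)) / k !)) := by
  have hre : (s + (k : ℂ)).re = s.re + k := by simp
  have hζ := norm_hurwitzZeta_le hα hα1 hx (w := s + k) (by rw [hre]; exact hxk)
  rw [hre, show x - (s.re + k) = x - s.re - k by ring] at hζ
  rw [norm_mul, mul_comm]
  exact mul_le_mul hζ (norm_coef_le s hR δ k) (norm_nonneg _)
    (mul_nonneg (Real.rpow_nonneg hα.le _) (tsum_nonneg fun n => by positivity))

/-- The Taylor series `Σ_k (-δ)^k s(s+1)⋯(s+k-1)/k! ζ(s+k, α)` of Lemma 6.2 converges absolutely at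
EVERY `s ∈ ℂ` (`0 < α ≤ 1`, `|δ| < α`): from the index `k₀ > 1 - Re s` on, its terms are majorised by a
constant times `‖s‖(‖s‖+1)⋯(‖s‖+k-1)/k! (|δ|/α)^k` (`norm_term_le`). (At the finitely many points
excluded in Lemma 6.2 the value of the sum is not `ζ(s, α+δ)`: there Mathlib's `ζ(1, α)` is a junk
value.) [cite: Platt2016GRH, Lemma 6.2 p. 3016] -/
theorem summable_terms {α δ : ℝ} (hα : 0 < α) (hα1 : α ≤ 1) (hδ : |δ| < α) (s : ℂ) :
    Summable (fun k : ℕ => (-(δ : ℂ)) ^ k * (∏ j ∈ Finset.range k, (s + j)) / (k ! : ℂ) *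
        hurwitzZeta (α : UnitAddCircle) (s + k)) := by
  obtain ⟨k₀, hk₀⟩ := exists_nat_gt (1 - s.re)
  set x : ℝ := s.re + k₀ with hx_def
  have hx : 1 < x := by rw [hx_def]; linarith
  set C : ℝ := α ^ (x - s.re) * ∑' n : ℕ, 1 / ((n : ℝ) + α) ^ x with hC
  have hδα : |δ| / α < 1 := (div_lt_one hα).mpr hδ
  have hmaj : Summable fun k : ℕ =>
      C * ((∏ j ∈ Finset.range k, (‖s‖ + j)) / k ! * (|δ| / α) ^ k) :=
    (summable_pochhammer_mul_pow (norm_nonneg s) (by positivity) hδα).mul_left C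
  refine Summable.of_norm_bounded_eventually hmaj ?_
  rw [Nat.cofinite_eq_atTop, Filter.eventually_atTop]
  refine ⟨k₀, fun k hk => ?_⟩
  have hxk : x ≤ s.re + k := by
    rw [hx_def]; gcongr
  refine (norm_term_le hα hα1 le_rfl k hx hxk).trans (le_of_eq ?_)
  rw [show x - s.re - k = (x - s.re) + (-(k : ℝ)) by ring, Real.rpow_add hα, Real.rpow_neg hα.le,
    Real.rpow_natCast, div_pow, hC]
  field_simp

/-- **The continuation step of Lemma 6.2**: the sum of the Taylor series
`G(s) = Σ_k (-δ)^k s(s+1)⋯(s+k-1)/k! ζ(s+k, α)` is holomorphic on `ℂ ∖ {1, 0, -1, …}`. Around each point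
`s₀` take a closed disc of radius `r` inside the domain; on it the terms with `k ≥ k₀` (`k₀ > 1 - Re s₀ + r`)
are majorised uniformly by `α^{-2r} ζ_ℝ(x, α) · R(R+1)⋯(R+k-1)/k! (|δ|/α)^k` (`x = Re s₀ - r + k₀`,
`R = ‖s₀‖ + r`; `norm_term_le`) and the finitely many earlier terms by compactness, so Mathlib's
`Complex.differentiableOn_tsum_of_summable_norm` applies on the open disc. This replaces the source's
"The Taylor expansion also gives us the analytic continuation to `ℂ ∖ ℤ_{≤0}`".
[cite: Platt2016GRH, Lemma 6.2 p. 3016 (proof)] -/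
theorem differentiableOn_tsum_terms {α δ : ℝ} (hα : 0 < α) (hα1 : α ≤ 1) (hδ : |δ| < α) :
    DifferentiableOn ℂ (fun s : ℂ => ∑' k : ℕ, (-(δ : ℂ)) ^ k * (∏ j ∈ Finset.range k, (s + j)) /
      (k ! : ℂ) * hurwitzZeta (α : UnitAddCircle) (s + k))
      (Set.range (fun n : ℕ => (1 : ℂ) - n))ᶜ := by
  set U : Set ℂ := (Set.range (fun n : ℕ => (1 : ℂ) - n))ᶜ with hU
  set c : ℕ → ℂ → ℂ := fun k s => (-(δ : ℂ)) ^ k * (∏ j ∈ Finset.range k, (s + j)) / (k ! : ℂ) *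
    hurwitzZeta (α : UnitAddCircle) (s + k) with hc
  -- off the exceptional set no `s + k` hits the pole
  have hpole : ∀ s ∈ U, ∀ k : ℕ, s + (k : ℂ) ≠ 1 := by
    intro s hs k h
    exact hs ⟨k, by rw [← h]; ring⟩
  have hcd : ∀ k, DifferentiableOn ℂ (c k) U := fun k s hs =>
    (differentiableAt_term α δ k (hpole s hs k)).differentiableWithinAt
  intro s₀ hs₀
  -- a closed disc around `s₀` inside `U`
  obtain ⟨ε, hε, hball⟩ := Metric.isOpen_iff.mp isOpen_compl_range s₀ hs₀
  set r : ℝ := ε / 2 with hr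
  have hr0 : 0 < r := by positivity
  have hKU : Metric.closedBall s₀ r ⊆ U :=
    (Metric.closedBall_subset_ball (by rw [hr]; linarith)).trans hball
  have hVK : Metric.ball s₀ r ⊆ Metric.closedBall s₀ r := Metric.ball_subset_closedBall
  -- the index from which all terms are honest Dirichlet series on the disc
  obtain ⟨k₀, hk₀⟩ := exists_nat_gt (1 - (s₀.re - r))
  set x : ℝ := s₀.re - r + k₀ with hx_def
  have hx : 1 < x := by rw [hx_def]; linarith
  set Z : ℝ := ∑' n : ℕ, 1 / ((n : ℝ) + α) ^ x with hZ
  have hZ0 : 0 ≤ Z := tsum_nonneg fun n => by positivity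
  set R : ℝ := ‖s₀‖ + r with hR_def
  -- bound of the finitely many early terms on the compact disc
  obtain ⟨M, hM⟩ := (isCompact_closedBall s₀ r).exists_bound_of_continuousOn
    (f := fun s => ∑ k ∈ Finset.range k₀, ‖c k s‖)
    (by
      refine continuousOn_finsetSum _ fun k _ => ?_
      exact ((hcd k).mono hKU).continuousOn.norm)
  -- the majorant
  have hδα : |δ| / α < 1 := (div_lt_one hα).mpr hδ
  set u : ℕ → ℝ := fun k => (if k < k₀ then M else 0) +
    α ^ (-(2 * r)) * Z * ((∏ j ∈ Finset.range k, (R + j)) / k ! * (|δ| / α) ^ k) with hu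
  have hus : Summable u := by
    refine Summable.add ?_
      ((summable_pochhammer_mul_pow (by positivity) (by positivity) hδα).mul_left _)
    refine summable_of_ne_finset_zero (s := Finset.range k₀) fun k hk => ?_
    rw [Finset.mem_range] at hk
    simp [hk]
  have hbound : ∀ k (s : ℂ), s ∈ Metric.ball s₀ r → ‖c k s‖ ≤ u k := by
    intro k s hs
    have hsK : s ∈ Metric.closedBall s₀ r := hVK hs
    have hdist : ‖s - s₀‖ ≤ r := by rwa [Metric.mem_closedBall, dist_eq_norm] at hsK
    have hsR : ‖s‖ ≤ R := by
      rw [hR_def]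
      calc ‖s‖ = ‖s₀ + (s - s₀)‖ := by ring_nf
        _ ≤ ‖s₀‖ + ‖s - s₀‖ := norm_add_le _ _
        _ ≤ ‖s₀‖ + r := by linarith
    have hre1 : s₀.re - r ≤ s.re := by
      have := abs_re_le_norm (s - s₀)
      rw [sub_re] at this
      linarith [(abs_le.mp (this.trans hdist)).1]
    have hre2 : s.re ≤ s₀.re + r := by
      have := abs_re_le_norm (s - s₀)
      rw [sub_re] at this
      linarith [(abs_le.mp (this.trans hdist)).2]
    have hnonneg :
        0 ≤ α ^ (-(2 * r)) * Z * ((∏ j ∈ Finset.range k, (R + j)) / k ! * (|δ| / α) ^ k) := by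
      have : 0 ≤ ∏ j ∈ Finset.range k, (R + j) :=
        Finset.prod_nonneg fun j _ => by rw [hR_def]; positivity
      positivity
    by_cases hk : k < k₀
    · -- early terms: the compactness bound
      have h1 : ‖c k s‖ ≤ ∑ i ∈ Finset.range k₀, ‖c i s‖ :=
        Finset.single_le_sum (f := fun i => ‖c i s‖) (fun i _ => norm_nonneg _)
          (Finset.mem_range.mpr hk)
      have h2 : ∑ i ∈ Finset.range k₀, ‖c i s‖ ≤ M := by
        have := hM s hsK
        rw [Real.norm_eq_abs, abs_of_nonneg (Finset.sum_nonneg fun i _ => norm_nonneg _)] at this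
        exact this
      rw [hu]
      simp only [hk, if_true]
      linarith
    · -- late terms: the Dirichlet-series majorant
      rw [not_lt] at hk
      have hxk : x ≤ s.re + k := by
        rw [hx_def]
        have : (k₀ : ℝ) ≤ k := by exact_mod_cast hk
        linarith
      refine (norm_term_le hα hα1 hsR k hx hxk).trans ?_
      rw [hu]
      simp only [show ¬ (k < k₀) from not_lt.mpr hk, if_false, zero_add]
      -- `α^{x - Re s - k} ≤ α^{-2r} α^{-k}`
      have hyz : -(2 * r) ≤ x - s.re := by
        rw [hx_def]
        have : (0 : ℝ) ≤ k₀ := Nat.cast_nonneg _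
        linarith
      have hexp : α ^ (x - s.re - k) ≤ α ^ (-(2 * r)) * α⁻¹ ^ k := by
        rw [show x - s.re - k = (x - s.re) + (-(k : ℝ)) by ring, Real.rpow_add hα,
          Real.rpow_neg hα.le (k : ℝ), Real.rpow_natCast, inv_pow]
        exact mul_le_mul_of_nonneg_right (Real.rpow_le_rpow_of_exponent_ge hα hα1 hyz)
          (by positivity)
      calc α ^ (x - s.re - ↑k) * Z * (|δ| ^ k * ((∏ j ∈ Finset.range k, (R + ↑j)) / ↑k !))
          ≤ α ^ (-(2 * r)) * α⁻¹ ^ k * Z *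
              (|δ| ^ k * ((∏ j ∈ Finset.range k, (R + ↑j)) / ↑k !)) := by
            have : 0 ≤ ∏ j ∈ Finset.range k, (R + j) :=
              Finset.prod_nonneg fun j _ => by rw [hR_def]; positivity
            gcongr
        _ = α ^ (-(2 * r)) * Z * ((∏ j ∈ Finset.range k, (R + ↑j)) / ↑k ! * (|δ| / α) ^ k) := by
            rw [div_pow, div_eq_mul_inv (|δ| ^ k), ← inv_pow]; ring
  have hV : DifferentiableOn ℂ (fun s => ∑' k, c k s) (Metric.ball s₀ r) :=
    differentiableOn_tsum_of_summable_norm hus (fun k => (hcd k).mono (hVK.trans hKU))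
      Metric.isOpen_ball hbound
  exact (hV.differentiableAt
    (Metric.isOpen_ball.mem_nhds (Metric.mem_ball_self hr0))).differentiableWithinAt

end HurwitzTaylor

open HurwitzTaylor

/-! ## §5 Lemma 6.2, its `ζ₁` form, and the truncation bound (Lemma 6.3) -/

/-- **Platt 2016, Lemma 6.2 (Math. Comp. 85, p. 3016; = arXiv:1305.3087v1 Lemma 4.2), as printed:**
"For `s ∉ ℤ_{≤0}`, `α ∈ (0, 1]` and `|δ| < α`,
`ζ(s, α + δ) = Σ_{k=0}^{∞} (-δ)^k ζ(s+k, α) (∏_{j=0}^{k-1} (s+j)) / k!`."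
Here `ζ(s, a) = Σ_{n ≥ 0} (n+a)^{-s}` (`Re s > 1`, `a ∈ (0,1]`; p. 3016) is Mathlib's
`HurwitzZeta.hurwitzZeta (a : UnitAddCircle) s` (`HurwitzZeta.hasSum_hurwitzZeta_of_one_lt_re`), and the
series is asserted as a `HasSum`. Hypotheses made explicit: `α + δ ≤ 1` (with `|δ| < α` this is
`α + δ ∈ (0, 1]`, i.e. `ζ(s, α+δ)` is defined in the source's sense — Mathlib's `hurwitzZeta` is
`1`-periodic in the parameter, so the identity is genuinely about `α + δ ∈ (0,1]`), and `s ≠ 1 - n` for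
every `n ∈ ℕ`, i.e. `s ∉ {1} ∪ ℤ_{≤0}`: the printed `s ∉ ℤ_{≤0}` together with the pole `s = 1` of both
sides (at `s = 1 - k`, `k ≥ 1`, the `k`-th term is `0 · ζ(1, α)`, whose printed meaning is a limit and
whose Mathlib value is junk — hence the exclusion, as in the source). Proof = the printed one:
`hasSum_taylor_of_one_lt_re` (`Re s > 1`, termwise binomial expansion and rearrangement) and analytic
continuation (`differentiableOn_tsum_terms`, identity theorem on the connected open set
`ℂ ∖ {1, 0, -1, …}` from the half-plane `Re s > 1`). This is the interpolation formula of Platt's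
Algorithm 1 (`L_χ(s) = q^{-s} Σ_{a=1}^{q} χ(a) ζ(s, a/q)`, p. 3016 — by definition Mathlib's
`ZMod.LFunction` —, evaluated from precomputed tables `ζ(1/2 + it + k, a/2^{11})`, §9.3 p. 3024).
[cite: Platt2016GRH, Lemma 6.2 p. 3016] -/
theorem platt2016_lemma62 {α δ : ℝ} (hα : 0 < α) (hα1 : α ≤ 1) (hδ : |δ| < α)
    (hαδ : α + δ ≤ 1) {s : ℂ} (hs : ∀ n : ℕ, s ≠ 1 - n) :
    HasSum (fun k : ℕ => (-(δ : ℂ)) ^ k * (∏ j ∈ Finset.range k, (s + j)) / (k ! : ℂ) *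
        hurwitzZeta (α : UnitAddCircle) (s + k))
      (hurwitzZeta ((α + δ : ℝ) : UnitAddCircle) s) := by
  set U : Set ℂ := (Set.range (fun n : ℕ => (1 : ℂ) - n))ᶜ with hU
  have hsU : s ∈ U := fun ⟨n, hn⟩ => hs n hn.symm
  set G : ℂ → ℂ := fun z => ∑' k : ℕ, (-(δ : ℂ)) ^ k * (∏ j ∈ Finset.range k, (z + j)) / (k ! : ℂ) *
    hurwitzZeta (α : UnitAddCircle) (z + k) with hG
  set F : ℂ → ℂ := fun z => hurwitzZeta ((α + δ : ℝ) : UnitAddCircle) z with hF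
  have hGa : AnalyticOnNhd ℂ G U :=
    (differentiableOn_tsum_terms hα hα1 hδ).analyticOnNhd isOpen_compl_range
  have hFd : DifferentiableOn ℂ F U := by
    intro z hz
    have hz1 : z ≠ 1 := fun h => hz ⟨0, by simp [h]⟩
    exact (differentiableAt_hurwitzZeta _ hz1).differentiableWithinAt
  have hFa : AnalyticOnNhd ℂ F U := hFd.analyticOnNhd isOpen_compl_range
  have hFG : F =ᶠ[𝓝 2] G := by
    have hO : IsOpen {z : ℂ | 1 < z.re} := isOpen_lt continuous_const Complex.continuous_re
    filter_upwards [hO.mem_nhds (by simp : (2 : ℂ) ∈ {z : ℂ | 1 < z.re})] with z hz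
    exact ((hasSum_taylor_of_one_lt_re hα hα1 hδ hαδ hz).tsum_eq).symm
  have hEq := hFa.eqOn_of_preconnected_of_eventuallyEq hGa isPreconnected_compl_range
    two_mem_compl_range hFG
  have hGs : G s = F s := (hEq hsU).symm
  rw [show hurwitzZeta ((α + δ : ℝ) : UnitAddCircle) s = G s from hGs.symm]
  exact (summable_terms hα hα1 hδ s).hasSum

/-- **Lemma 6.2 for `ζ₁`** (journal p. 3016: "In practice, it is better to work with
`ζ₁(s, α) = ζ(s, α) - α^{-s}` and recover `ζ(s, α)` by adding back the missing term"): under the hypotheses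
of `platt2016_lemma62`,
`ζ₁(s, α + δ) = Σ_{k ≥ 0} (-δ)^k s(s+1)⋯(s+k-1)/k! · ζ₁(s+k, α)`,
obtained by subtracting the binomial expansion `(α+δ)^{-s} = Σ_k (-δ)^k s(s+1)⋯(s+k-1)/k! α^{-(s+k)}`
(`HurwitzTaylor.hasSum_cpow_neg`) term by term. (arXiv v1 works instead with `ζ_M = ζ - Σ_{n ≤ M}(n+α)^{-s}`;
`-- TODO(general form)`: the same subtraction for `M + 1` leading terms.)
[cite: Platt2016GRH, Lemma 6.2 and §6.1 p. 3016] -/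
theorem platt2016_lemma62_zeta1 {α δ : ℝ} (hα : 0 < α) (hα1 : α ≤ 1) (hδ : |δ| < α)
    (hαδ : α + δ ≤ 1) {s : ℂ} (hs : ∀ n : ℕ, s ≠ 1 - n) :
    HasSum (fun k : ℕ => (-(δ : ℂ)) ^ k * (∏ j ∈ Finset.range k, (s + j)) / (k ! : ℂ) *
        (hurwitzZeta (α : UnitAddCircle) (s + k) - (α : ℂ) ^ (-(s + k))))
      (hurwitzZeta ((α + δ : ℝ) : UnitAddCircle) s - ((α + δ : ℝ) : ℂ) ^ (-s)) := by
  have h := (platt2016_lemma62 hα hα1 hδ hαδ hs).sub (hasSum_cpow_neg hα hδ s)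
  refine h.congr_fun fun k => ?_   -- or convert
  ring

/-- **Truncation of the Taylor series — a rigorous form of Platt 2016, Lemma 6.3 (journal pp. 3016–3017;
not in arXiv v1).** Printed: "If we use the first `τ` terms of the Taylor approximation to `ζ₁(s, α+δ)`,
then the absolute error is bounded by `(τ+1)|s(s+1)⋯(s+τ-1) ζ₁(s+τ, α)| δ^τ / (τ! (τ + 1 - (|s|+τ)δ))`
and the approximation is valid for `(|s|+τ)δ/(τ+1) < 1`. *Proof.* The first term dropped is
`s(s+1)⋯(s+τ-1)ζ₁(s+τ,α)δ^τ/τ!` and the result follows by considering the geometric sequence with this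
first term and with common ratio `(|s|+τ)δ/(τ+1)`."
PROVED HERE (hypotheses of `platt2016_lemma62`, `Re s + τ > 1`): the tail after `τ` terms of the
`ζ₁`-series (`platt2016_lemma62_zeta1`) satisfies
`‖ζ₁(s, α+δ) - Σ_{k<τ} (-δ)^k s⋯(s+k-1)/k! ζ₁(s+k, α)‖ ≤ ‖s(s+1)⋯(s+τ-1)‖ · ζ₁(Re s + τ, α) · |δ|^τ / (τ! (1 - r))`,
`ζ₁(x, α) = Σ_{n ≥ 1} (n+α)^{-x}` (a real number, written as the `tsum`), with the common ratio
`r = max(1, (‖s‖+τ)/(τ+1)) · |δ| / (1+α) < 1` — the geometric majorant of the PROVED termwise bounds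
`‖ζ₁(s+k, α)‖ ≤ (1+α)^{τ-k} ζ₁(Re s+τ, α)` (`HurwitzTaylor.norm_hurwitzZeta_sub_le`) and
`‖s⋯(s+k)‖/(k+1)! ≤ max(1, (‖s‖+τ)/(τ+1)) · ‖s⋯(s+k-1)‖/k!` for `k ≥ τ`
(`HurwitzTaylor.norm_pochhammer_div_factorial_le`). Relation to print (recorded, no silent change): the
modulus `|ζ₁(s+τ, α)|` of the first omitted coefficient is replaced by its real majorant
`ζ₁(Re s + τ, α) ≥ |ζ₁(s+τ, α)|` (the later coefficients `ζ₁(s+k, α)`, `k > τ`, are controlled by the real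
values, not by `|ζ₁(s+τ, α)|`), and for `|s| ≥ 1` (Platt's `s = 1/2 + it`) our ratio is
`(|s|+τ)|δ|/((τ+1)(1+α)) ≤` the printed `(|s|+τ)δ/(τ+1)`; the printed inequality itself is not asserted.
With Platt's parameters (`τ = 15`, `δ ≤ 2^{-12}`, `Re s = 1/2`, §9.3 p. 3024) both forms are geometric
series of ratio `< 10^{-2}`. [cite: Platt2016GRH, Lemma 6.3 pp. 3016–3017] -/
theorem platt2016_lemma63_majorant {α δ : ℝ} (hα : 0 < α) (hα1 : α ≤ 1) (hδ : |δ| < α)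
    (hαδ : α + δ ≤ 1) {s : ℂ} (hs : ∀ n : ℕ, s ≠ 1 - n) {τ : ℕ} (hτ : 1 < s.re + τ)
    (hq : max 1 ((‖s‖ + τ) / (τ + 1)) * |δ| < 1 + α) :
    ‖(hurwitzZeta ((α + δ : ℝ) : UnitAddCircle) s - ((α + δ : ℝ) : ℂ) ^ (-s)) -
        ∑ k ∈ Finset.range τ, (-(δ : ℂ)) ^ k * (∏ j ∈ Finset.range k, (s + j)) / (k ! : ℂ) *
          (hurwitzZeta (α : UnitAddCircle) (s + k) - (α : ℂ) ^ (-(s + k)))‖ ≤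
      ‖∏ j ∈ Finset.range τ, (s + j)‖ * (∑' n : ℕ, 1 / ((n : ℝ) + 1 + α) ^ (s.re + τ)) *
        |δ| ^ τ / (τ ! * (1 - max 1 ((‖s‖ + τ) / (τ + 1)) * |δ| / (1 + α))) := by
  set ρ : ℝ := max 1 ((‖s‖ + τ) / (τ + 1)) with hρ
  set q : ℝ := ρ * |δ| / (1 + α) with hq_def
  have hρ1 : 1 ≤ ρ := le_max_left _ _
  have hq0 : 0 ≤ q := by positivity
  have hq1 : q < 1 := by rw [hq_def, div_lt_one (by positivity)]; exact hq
  set Z : ℝ := ∑' n : ℕ, 1 / ((n : ℝ) + 1 + α) ^ (s.re + τ) with hZ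
  have hZ0 : 0 ≤ Z := tsum_nonneg fun n => by positivity
  set P : ℝ := ‖∏ j ∈ Finset.range τ, (s + j)‖ with hP
  set A : ℝ := P / τ ! * Z * |δ| ^ τ with hA
  -- the tail as a series
  set c : ℕ → ℂ := fun k => (-(δ : ℂ)) ^ k * (∏ j ∈ Finset.range k, (s + j)) / (k ! : ℂ) *
    (hurwitzZeta (α : UnitAddCircle) (s + k) - (α : ℂ) ^ (-(s + k))) with hc
  have hmain := platt2016_lemma62_zeta1 hα hα1 hδ hαδ hs
  have htail : HasSum (fun m : ℕ => c (m + τ))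
      ((hurwitzZeta ((α + δ : ℝ) : UnitAddCircle) s - ((α + δ : ℝ) : ℂ) ^ (-s)) -
        ∑ k ∈ Finset.range τ, c k) :=
    (hasSum_nat_add_iff' τ).mpr hmain
  -- the geometric majorant
  have hgeom : HasSum (fun m : ℕ => A * q ^ m) (A * (1 - q)⁻¹) :=
    (hasSum_geometric_of_lt_one hq0 hq1).mul_left A
  have hbound : ∀ m : ℕ, ‖c (m + τ)‖ ≤ A * q ^ m := by
    intro m
    have hre : (s + ((m + τ : ℕ) : ℂ)).re = s.re + (m + τ : ℕ) := by simp
    have hxw : s.re + τ ≤ (s + ((m + τ : ℕ) : ℂ)).re := by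
      rw [hre]; push_cast; linarith [(m.cast_nonneg : (0 : ℝ) ≤ m)]
    have hζ := norm_hurwitzZeta_sub_le hα hα1 hτ hxw
    rw [hre, show s.re + τ - (s.re + ((m + τ : ℕ) : ℝ)) = -(m : ℝ) by push_cast; ring,
      Real.rpow_neg (by positivity), Real.rpow_natCast] at hζ
    have hcoef := norm_coef_eq s δ (m + τ)
    have hpoch := norm_pochhammer_div_factorial_le s τ m
    rw [show τ + m = m + τ by ring] at hpoch
    simp only [hc]
    rw [norm_mul]
    calc ‖(-(δ : ℂ)) ^ (m + τ) * (∏ j ∈ Finset.range (m + τ), (s + j)) / ((m + τ) ! : ℂ)‖ *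
          ‖hurwitzZeta (α : UnitAddCircle) (s + ((m + τ : ℕ) : ℂ)) -
            (α : ℂ) ^ (-(s + ((m + τ : ℕ) : ℂ)))‖
        ≤ (|δ| ^ (m + τ) * (‖∏ j ∈ Finset.range (m + τ), (s + j)‖ / (m + τ) !)) *
            (((1 + α) ^ m)⁻¹ * Z) :=
          mul_le_mul hcoef.le hζ (norm_nonneg _) (by positivity)
      _ ≤ (|δ| ^ (m + τ) * (ρ ^ m * (P / τ !))) * (((1 + α) ^ m)⁻¹ * Z) := by
          gcongr
      _ = A * q ^ m := by
          rw [hA, hq_def, pow_add, div_pow, mul_pow]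
          field_simp
  have hle := htail.norm_le_of_bounded hgeom hbound
  refine hle.trans (le_of_eq ?_)
  rw [hA, hq_def]
  field_simp

end Literature.NumberTheory.LFunctions

end
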